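import Summits.BirchSwinnertonDyer.BirchSwinnertonDyer.Theorems.KolyvaginDepthDoorDepthTableKuriharaDecisivePrime
import Summits.BirchSwinnertonDyer.BirchSwinnertonDyer.Theorems.KolyvaginDepthDoorDepthTableKuriharaSocket446d1
import Summits.BirchSwinnertonDyer.Rank1Residual.Supersingular.CountPointsFast
import HarnessLib

/-!
# Route `KolyvaginDepthDoor`, crux `KolyvaginDepthSupplyKN` (stmt-BirchSwinnertonDyer-22820) —
# DEPTH TABLE v19, ROW `446d1` @ `(7, d_K = -23)`: THE DECISIVE PRIME `ℓ★ = 71` — the row's bit ⟺ a unit mod-`7`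
# Kurihara number of the twist model `T₀ = [1, -1, 0, -2215, -35567]` AT THE ONE PRIME `71` (kernel: `12 • P̄ ≠ O` in `T̃₀(𝔽_71)` for
# `P = (54, -17)`, `#T̃₀(𝔽_71) = 84 = 7·12`)

Helper file of the lead prover of line `levelone` (kdd-p1 g23; `--supports stmt-BirchSwinnertonDyer-22820
--as helper`); it closes nothing and BSD is NOT proved by it. Same template as `…KuriharaDecisive709a1`.

v18 (g22, `…KuriharaSocket446d1`) read the row EXACTLY as «bit ⟺ SOME cyclic Kolyvagin prime `ℓ` of `(T₀, 7)` carries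
a unit `δ̃_ℓ(T₀)`», and CLOSING-DATA-v18 §2b marked `ℓ = 71` with ★ (the known point `P = (54, -17)` of `T₀` is not
divisible by `7` in `T̃₀(𝔽_71)` — a heuristic there). v19 makes the ★ a THEOREM-LEVEL statement: by the generic
`…KuriharaDecisivePrime` (Sakamoto 2022 Lemma 4.4 + Lemma 4.6 (1) BY NAME, `hSak3`), the bit — which gives `#Sel_7(E^{(-23)}) ≤ 7`
by the row's exact reading — FORCES `δ̃_71(T₀) ≢ 0 (mod 7)`, the local `7`-indivisibility of `P` at `71` being
KERNEL-CHECKED here (`minTwist23_localNondivisible_71`: an affine double-and-add chain of 4 certified steps reaching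
`12 • P̄ = (33, 42) ≠ O` in `T̃₀(𝔽_71)` by `decide`, `7·12 = #T̃₀(𝔽_71) = 84`, and the bridge `localNondivisible_of_chainB`).
Conversely a unit at `71` closes the row by the socket. HENCE

* `twistKuriharaBit_iff_unit_71` — **bit ⟺ unit `δ̃_71(T₀)`** (for every admissible datum of `T₀`): the fleet's ONE
  residue `δ̃_71(T₀) mod 7` DECIDES the row `446d1` @ `(7, -23)` BOTH WAYS modulo print — a computed ZERO refutes the
  crux's clause at `(7, ℚ(√-23))` for `446d1` (the row then moves to another admissible prime / Heegner field), a UNIT proves it.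

Kernel lemmas: `minTwist23_card_71` (`#T̃₀(𝔽_71) = 84`, `a_71(T₀) = -12 ≡ 2 (mod 7)`), `minTwist23_isCyclicKolyvaginLevel_7_71`,
`minTwist23_localNondivisible_71`. CONDITIONAL on the named facts displayed and the E-side record claim `hδE`; per curve; nothing
class-wide; BSD is NOT proved by any of this.

References: [Sakamoto2022pSelmer] Lemma 4.4, Lemma 4.6 (1), Thm. 1.2, Thm. 1.5; [Kim2022StructureSelmer] Thm. 1.11;
[Kurihara2014] §5.3; [SilvermanAEC2009] III.2.3, VII.2.1, VII.3.1; [CremonaAlgorithms1997] Table 1 (446d1).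
-/

set_option linter.dupNamespace false

noncomputable section

open scoped Classical NumberField

namespace Summit.BirchSwinnertonDyer.BirchSwinnertonDyer.Theorems.KolyvaginDepthDoor

open Literature.NumberTheory.EllipticCurves Literature.NumberTheory.EllipticCurves.ModularForms
  WeierstrassCurve NumberField IsDedekindDomain
open Summit.BirchSwinnertonDyer.BirchSwinnertonDyer.Theorems
open Summit.BirchSwinnertonDyer.BirchSwinnertonDyer.Rank2Observatory
open Summit.BirchSwinnertonDyer.BirchSwinnertonDyer.Rank1Residual (IntModel.frobeniusTrace_eq)
open Summit.BirchSwinnertonDyer.Rank1Residual.Supersingular (natCard_point_eq_of_countPoints countPoints_eq_of_fast)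
open Summit.BirchSwinnertonDyer.Rank1Residual.Additive (card_torsion_le_of_intModel_of_card
  isKolyvaginPrime_of_intModel_of_card)

namespace C446d1

/-- `#T̃₀(𝔽_71) = 84 = 7·12` for `T₀ = [1, -1, 0, -2215, -35567]` (`71 ≡ 1 (mod 7)`, `a_71(T₀) = -12 ≡ 2 (mod 7)`, `7² ∤ 84`),
kernel-decided (`countPointsFast`). [cite: Kim2022StructureSelmer, §1.2.2 (PDF p. 5)] -/
theorem minTwist23_card_71 :
    Nat.card (((⟨1, -1, 0, -2215, -35567⟩ : WeierstrassCurve ℤ).map (Int.castRingHom (ZMod 71))).toAffine.Point) = 84 :=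
  haveI : Fact (Nat.Prime 71) := ⟨by norm_num⟩
  natCard_point_eq_of_countPoints 1 (-1) 0 (-2215) (-35567) 71 (by norm_num) (by decide +kernel) (n := 84)
    (countPoints_eq_of_fast (by decide +kernel))

/-- **`71` is a CYCLIC KOLYVAGIN PRIME for `(T₀, 7)`** (`71 ∤ 7·N_{T₀}`, `71 ≡ 1`, `a_71(T₀) ≡ 2 (mod 7)`,
`#T̃₀(𝔽_71)[7] ≤ 7`) — a ★ candidate of CLOSING-DATA-v18 §2b. [cite: Kim2022StructureSelmer, §1.2.2 (PDF p. 5)] -/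
theorem minTwist23_isCyclicKolyvaginLevel_7_71 :
    haveI := minTwist23_isGloballyMinimal; haveI := Fact.mk (by norm_num : Nat.Prime 7);
    IsCyclicKolyvaginLevel ((⟨1, -1, 0, -2215, -35567⟩ : WeierstrassCurve ℤ).map (Int.castRingHom ℚ)) 7 71 := by
  haveI := minTwist23_isElliptic
  haveI := minTwist23_isGloballyMinimal
  haveI := Fact.mk (by norm_num : Nat.Prime 7)
  haveI : Fact (Nat.Prime 71) := ⟨by norm_num⟩
  have hℓ : Kato.IsKolyvaginPrime ((⟨1, -1, 0, -2215, -35567⟩ : WeierstrassCurve ℤ).map (Int.castRingHom ℚ)) 7 1 71 :=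
    isKolyvaginPrime_of_intModel_of_card minTwist23_intModel 7 1 71 (by norm_num) (by decide +kernel) (by decide)
      minTwist23_card_71 (by norm_num)
  refine ⟨⟨Nat.squarefree_iff_nodup_primeFactorsList (by norm_num) |>.mpr (by simp), fun ℓ hℓ' ↦ ?_⟩, fun ℓ hℓ' hdvd ↦ ?_⟩
  · rw [show (71 : ℕ).primeFactors = {71} from (Nat.Prime.primeFactors (by norm_num)), Finset.mem_singleton] at hℓ'
    exact hℓ' ▸ hℓ
  · obtain rfl := (Nat.prime_dvd_prime_iff_eq hℓ'.out (by norm_num)).mp hdvd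
    exact card_torsion_le_of_intModel_of_card minTwist23_intModel 7 71 minTwist23_card_71 (by norm_num)

/-- The rational point `P = (54, -17)` of `T₀ = [1, -1, 0, -2215, -35567]` (integral; on the curve). [folklore] -/
theorem minTwist23_nonsingular_P :
    ((⟨1, -1, 0, -2215, -35567⟩ : WeierstrassCurve ℤ).map (Int.castRingHom ℚ)).toAffine.Nonsingular ((54 : ℤ) : ℚ) ((-17 : ℤ) : ℚ) :=
  nonsingular_rat_of_eq _ (by decide +kernel) (by norm_num)

/-- The double-and-add chain from `P̄` reaches the multiplier `12`. [folklore] -/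
theorem chain71_mult :
    chainMult 1 [(true, ((33 : ℤ) : ZMod 71), ((67 : ℤ) : ZMod 71)), (false, ((68 : ℤ) : ZMod 71), ((5 : ℤ) : ZMod 71)), (true, ((13 : ℤ) : ZMod 71), ((21 : ℤ) : ZMod 71)), (true, ((33 : ℤ) : ZMod 71), ((42 : ℤ) : ZMod 71))] = 12 := by
  decide

/-- The double-and-add chain from `P̄ = (54, -17)` to `12 • P̄ = (33, 42)` in `T̃₀(𝔽_71)` CHECKS (tangent / chord
certificates, `decide`). [cite: SilvermanAEC2009, III.2.3] -/
theorem chain71_ok :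
    chainB (⟨1, -1, 0, -2215, -35567⟩ : WeierstrassCurve ℤ) 71 (((54 : ℤ)) : ZMod 71) (((-17 : ℤ)) : ZMod 71)
      ((((54 : ℤ)) : ZMod 71), (((-17 : ℤ)) : ZMod 71))
      [(true, ((33 : ℤ) : ZMod 71), ((67 : ℤ) : ZMod 71)), (false, ((68 : ℤ) : ZMod 71), ((5 : ℤ) : ZMod 71)), (true, ((13 : ℤ) : ZMod 71), ((21 : ℤ) : ZMod 71)), (true, ((33 : ℤ) : ZMod 71), ((42 : ℤ) : ZMod 71))] = true := by
  decide +kernel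

/-- **KERNEL: `P = (54, -17)` is not divisible by `7` in `T₀(ℚ_71)`** — the chain certifies `12 • P̄ ≠ O` in `T̃₀(𝔽_71)`,
`7·12 = #T̃₀(𝔽_71)`, and `localNondivisible_of_chainB`. This is the ★ of CLOSING-DATA-v18 §2b for `446d1` at `71`, now in
the kernel. [cite: SilvermanAEC2009, III.2.3, VII.2 Prop. 2.1, VII.3 Prop. 3.1] -/
theorem minTwist23_localNondivisible_71 :
    haveI : Fact (Nat.Prime 71) := ⟨by norm_num⟩;
    ∀ Q : (((⟨1, -1, 0, -2215, -35567⟩ : WeierstrassCurve ℤ).map (Int.castRingHom ℚ)).baseChange ℚ_[71]).toAffine.Point,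
      7 • Q ≠ WeierstrassCurve.Affine.Point.map (W' := ((⟨1, -1, 0, -2215, -35567⟩ : WeierstrassCurve ℤ).map (Int.castRingHom ℚ)).toAffine)
        (S := ℚ) (Algebra.ofId ℚ ℚ_[71]) (.some ((54 : ℤ) : ℚ) ((-17 : ℤ) : ℚ) minTwist23_nonsingular_P) := by
  haveI : Fact (Nat.Prime 71) := ⟨by norm_num⟩
  have hq : ¬ ((71 : ℕ) : ℤ) ∣ (⟨1, -1, 0, -2215, -35567⟩ : WeierstrassCurve ℤ).Δ := by decide +kernel
  have hXY : (⟨1, -1, 0, -2215, -35567⟩ : WeierstrassCurve ℤ).toAffine.Equation (54) (-17) :=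
    (Affine.equation_iff _ _).mpr (by norm_num)
  have hpk : 7 * 12 = Nat.card (((⟨1, -1, 0, -2215, -35567⟩ : WeierstrassCurve ℤ).map (Int.castRingHom (ZMod 71))).toAffine.Point) := by
    rw [minTwist23_card_71]
  exact localNondivisible_of_chainB (⟨1, -1, 0, -2215, -35567⟩ : WeierstrassCurve ℤ) 71 hq hXY minTwist23_nonsingular_P hpk
    chain71_mult (by convert chain71_ok)

/-- **ROW `446d1` @ `(7, -23)`: THE DECISIVE PRIME `71` — bit ⟺ unit `δ̃_71(T₀)`.** For every imaginary quadratic `K`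
with `d_K = -23`, granted the named facts displayed and the E-side record claim `hδE`: «some frame, some Kolyvagin PRIME
`ℓ`, some Kolyvagin–Heegner datum of conductor `ℓ` with `c_1(ℓ) ≠ 0`» (the depth-table bit) holds IF AND ONLY IF «every
datum `D` of `T₀` at level `N_{T₀}` with `7 ∤ c_D` and the period transfer has a UNIT mod-`7` Kurihara number AT `71`» —
the claim of a future tree record `cert_<T₀>` @ `(7, 71)`. (⟹): bit ⟹ `#Sel_7(E^{(-23)}) ≤ 7` (the socket's exact reading
∘ v18's twist IFF) ⟹ unit at `71` (`twistKuriharaClaim_prime_of_natCard_selmerGroup_le` with the kernel certificate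
`minTwist23_localNondivisible_71`); (⟸): the exact reading with `m = 71` (`minTwist23_isCyclicKolyvaginLevel_7_71`, `ν(71) = 1`).
CONDITIONAL on the named facts and the claim; per curve; BSD is not proved by it.
[cite: Sakamoto2022pSelmer, Lemma 4.4, Lemma 4.6 (1), Thm. 1.2, Thm. 1.5] [cite: Kim2022StructureSelmer, Thm. 1.11]
[cite: CremonaAlgorithms1997, Table 1 (446d1)] -/
theorem twistKuriharaBit_iff_unit_71
    (h372 : GrossLMS1991.prop37_2_frobeniusCongruence)
    (h84 : Literature.NumberTheory.EllipticCurves.WZhang2014_lemma84_exists_minimal_kolyvaginClass_one_selmerCard)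
    (hKim : Kim2022_card_selmerGroup_le_pow_of_kuriharaNumber_ne_zero)
    (hSak1 : Sakamoto2022_card_selmerGroup_eq_pow_of_isDeltaMinimal)
    (hSak2 : Sakamoto2022_exists_cyclicLevel_kuriharaNumber_ne_zero)
    (hSak3 : Literature.NumberTheory.EllipticCurves.Sakamoto2022_kuriharaNumber_prime_ne_zero_of_localNondivisible)
    (hnf : exists_isNewformOf) (hMaz : mazur_not_dvd_maninConstant_of_odd)
    (K : Type) [Field K] [NumberField K] (hK : IsImaginaryQuadratic K) (hD : NumberField.discr K = -23)
    (hδE : haveI := isElliptic_c446d1; haveI := isGloballyMinimal_c446d1;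
      haveI : NeZero (((⟨1, -1, 0, -4, 4⟩ : WeierstrassCurve ℤ).map (Int.castRingHom ℚ)).conductorNorm ℤ) := neZero_conductorNorm_of_isElliptic _;
      haveI := Fact.mk (by norm_num : Nat.Prime 7);
      ∀ (D : ModularParametrizationData ((⟨1, -1, 0, -4, 4⟩ : WeierstrassCurve ℤ).map (Int.castRingHom ℚ)) (((⟨1, -1, 0, -4, 4⟩ : WeierstrassCurve ℤ).map (Int.castRingHom ℚ)).conductorNorm ℤ)), ¬ ((7 : ℕ) : ℤ) ∣ D.maninConstant →
        (∃ u : ℚ, ‖(u : ℚ_[7])‖ = 1 ∧ ((⟨1, -1, 0, -4, 4⟩ : WeierstrassCurve ℤ).map (Int.castRingHom ℚ)).realPeriodRat = u * plusPeriod D.f) →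
        ∃ ψ : (ℓ : ℕ) → (ZMod ℓ)ˣ →* Multiplicative (ZMod 7),
          (∀ ℓ ∈ (8023 : ℕ).primeFactors, Function.Surjective (ψ ℓ)) ∧ kuriharaNumber D.f 7 8023 ψ ≠ 0) :
    haveI := isElliptic_c446d1; haveI := isGloballyMinimal_c446d1;
    haveI : NeZero (((⟨1, -1, 0, -4, 4⟩ : WeierstrassCurve ℤ).map (Int.castRingHom ℚ)).conductorNorm ℤ) := neZero_conductorNorm_of_isElliptic _;
    haveI := minTwist23_isElliptic; haveI := minTwist23_isGloballyMinimal;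
    haveI : NeZero (((⟨1, -1, 0, -2215, -35567⟩ : WeierstrassCurve ℤ).map (Int.castRingHom ℚ)).conductorNorm ℤ) := neZero_conductorNorm_of_isElliptic _;
    haveI := Fact.mk (by norm_num : Nat.Prime 7);
    (∃ (Dt : ModularParametrizationData ((⟨1, -1, 0, -4, 4⟩ : WeierstrassCurve ℤ).map (Int.castRingHom ℚ)) (((⟨1, -1, 0, -4, 4⟩ : WeierstrassCurve ℤ).map (Int.castRingHom ℚ)).conductorNorm ℤ)) (β : ℤ)
      (ι : K →+* ℂ) (ℓ : ℕ) (d : KolyvaginHeegnerData Dt β ι ℓ),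
      ℓ.Prime ∧ Zhang2014.IsKolyvaginPrime (((⟨1, -1, 0, -4, 4⟩ : WeierstrassCurve ℤ).map (Int.castRingHom ℚ)).conductorNorm ℤ) ((⟨1, -1, 0, -4, 4⟩ : WeierstrassCurve ℤ).map (Int.castRingHom ℚ)) K 7 ℓ ∧
        d.kolyvaginClass (p := 7) (by norm_num) 1 ≠ 0) ↔
    (∀ (D : ModularParametrizationData ((⟨1, -1, 0, -2215, -35567⟩ : WeierstrassCurve ℤ).map (Int.castRingHom ℚ))
          (((⟨1, -1, 0, -2215, -35567⟩ : WeierstrassCurve ℤ).map (Int.castRingHom ℚ)).conductorNorm ℤ)),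
        ¬ ((7 : ℕ) : ℤ) ∣ D.maninConstant →
        (∃ u : ℚ, ‖(u : ℚ_[7])‖ = 1 ∧
          ((⟨1, -1, 0, -2215, -35567⟩ : WeierstrassCurve ℤ).map (Int.castRingHom ℚ)).realPeriodRat = u * plusPeriod D.f) →
        ∃ ψ : (q : ℕ) → (ZMod q)ˣ →* Multiplicative (ZMod 7),
          (∀ q ∈ (71 : ℕ).primeFactors, Function.Surjective (ψ q)) ∧ kuriharaNumber D.f 7 71 ψ ≠ 0) := by
  haveI := isElliptic_c446d1
  haveI := isGloballyMinimal_c446d1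
  haveI iNZ : NeZero (((⟨1, -1, 0, -4, 4⟩ : WeierstrassCurve ℤ).map (Int.castRingHom ℚ)).conductorNorm ℤ) :=
    neZero_conductorNorm_of_isElliptic _
  haveI := minTwist23_isElliptic
  haveI := minTwist23_isGloballyMinimal
  haveI iNZT : NeZero (((⟨1, -1, 0, -2215, -35567⟩ : WeierstrassCurve ℤ).map (Int.castRingHom ℚ)).conductorNorm ℤ) :=
    neZero_conductorNorm_of_isElliptic _
  haveI iP := Fact.mk (by norm_num : Nat.Prime 7)
  haveI : Fact (Nat.Prime 71) := ⟨by norm_num⟩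
  haveI : NeZero (71 : ℕ) := ⟨by norm_num⟩
  have hsur : ((⟨1, -1, 0, -4, 4⟩ : WeierstrassCurve ℤ).map (Int.castRingHom ℚ)).HasSurjectiveModNGaloisRep ((7 : ℕ) : ℤ) := by
    simpa using hasSurjectiveModNGaloisRep_7
  have htower : ∀ k : ℕ, ((⟨1, -1, 0, -4, 4⟩ : WeierstrassCurve ℤ).map (Int.castRingHom ℚ)).HasSurjectiveModNGaloisRep ((7 : ℕ) ^ k : ℕ) :=
    serre_hasSurjectiveModNGaloisRep_pow_holds _ 7 (by norm_num) hsur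
  have hsp := spadeOne_of_five_le 7 (by norm_num)
  have hS2 : ¬ Squarefree (((⟨1, -1, 0, -4, 4⟩ : WeierstrassCurve ℤ).map (Int.castRingHom ℚ)).conductorNorm ℤ) →
      (∃ (ℓ : ℕ) (_ : Fact ℓ.Prime), ((⟨1, -1, 0, -4, 4⟩ : WeierstrassCurve ℤ).map (Int.castRingHom ℚ)).HasMultiplicativeReductionAtPrime ℓ ∧
          ¬ 7 ∣ padicValInt ℓ ((⟨1, -1, 0, -4, 4⟩ : WeierstrassCurve ℤ).map (Int.castRingHom ℚ)).minimalDiscriminantInt) ∧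
        ∃ (ℓ₁ ℓ₂ : ℕ) (_ : Fact ℓ₁.Prime) (_ : Fact ℓ₂.Prime), ℓ₁ ≠ ℓ₂ ∧
          ((⟨1, -1, 0, -4, 4⟩ : WeierstrassCurve ℤ).map (Int.castRingHom ℚ)).HasMultiplicativeReductionAtPrime ℓ₁ ∧
          ((⟨1, -1, 0, -4, 4⟩ : WeierstrassCurve ℤ).map (Int.castRingHom ℚ)).HasMultiplicativeReductionAtPrime ℓ₂ :=
    fun hns ↦ absurd ((((⟨1, -1, 0, -4, 4⟩ : WeierstrassCurve ℤ).map (Int.castRingHom ℚ))).isSemistable_iff_squarefree_conductorNorm.mp hsp.2) hns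
  have hH := satisfiesHeegnerHypothesis_conductorNorm_of_intModel intModel K hK.1 hD heegner_neg23
  have hD3 : NumberField.discr K ≠ -3 := by rw [hD]; norm_num
  have hD4 : NumberField.discr K ≠ -4 := by rw [hD]; norm_num
  have hpD : ¬ (((7 : ℕ) : ℤ) ∣ NumberField.discr K) := by rw [hD]; decide
  have hC : (⟨1, (6 : ℚ), -((1 : ℚ) / 2), (-3 : ℚ)⟩ : WeierstrassCurve.VariableChange ℚ) •
      ((⟨1, -1, 0, -2215, -35567⟩ : WeierstrassCurve ℤ).map (Int.castRingHom ℚ)) =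
      ((⟨1, -1, 0, -4, 4⟩ : WeierstrassCurve ℤ).map (Int.castRingHom ℚ)).quadraticTwist ((NumberField.discr K : ℤ) : ℚ) := by
    rw [hD]; push_cast; exact minTwist23_smul_eq
  have hr2 := Summit.BirchSwinnertonDyer.BirchSwinnertonDyer.Rank2Observatory.C446d1.mordellWeilRank_eq_two
  have hiff := kolyvaginPrime_iff_twistKuriharaBit_7_neg23 h372 h84 hKim hSak1 hSak2 hnf hMaz K hK hD hδE
  constructor
  · intro hbit D hc hu
    have hT := (natCard_selmerGroup_quadraticTwist_le_iff_kuriharaBit hKim hSak1 hSak2 hnf hMaz _ 7 (by norm_num) goodOrdinary_7.1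
      goodOrdinary_7.2 hsur (NumberField.discr_ne_zero K) hpD _ _ hC minTwist23_nonAnomalous_7 (minTwist23_kodairaNeron_of_five_le 7 (by norm_num)) 1).mpr (hiff.mp hbit)
    rw [pow_one] at hT
    exact twistKuriharaClaim_prime_of_natCard_selmerGroup_le hSak3 _ 7 (by norm_num) goodOrdinary_7.1 goodOrdinary_7.2 hsur
      (NumberField.discr_ne_zero K) hpD _ _ hC minTwist23_nonAnomalous_7 (minTwist23_kodairaNeron_of_five_le 7 (by norm_num)) hT 71
      minTwist23_isCyclicKolyvaginLevel_7_71 _ minTwist23_localNondivisible_71 D hc hu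
  · intro hunit
    refine hiff.mpr fun D hc hu ↦ ?_
    obtain ⟨ψ, hψ, hne⟩ := hunit D hc hu
    refine ⟨71, inferInstance, minTwist23_isCyclicKolyvaginLevel_7_71, ?_, ψ, hψ, hne⟩
    rw [Nat.Prime.primeFactors (by norm_num), Finset.card_singleton]

end C446d1

end Summit.BirchSwinnertonDyer.BirchSwinnertonDyer.Theorems.KolyvaginDepthDoor

end
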